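import Mathlib.GroupTheory.SpecificGroups.Cyclic
import Mathlib.Algebra.Group.Subgroup.Finite
import Mathlib.Algebra.Ring.Int.Parity
import Mathlib.Tactic.Group
import Mathlib.Tactic.Ring
import Mathlib.Tactic.Linarith
import Mathlib.Tactic.Positivity
import HarnessLib

/-!
# The subgroup `⟨a, y⟩` of two commuting elements (`a` of order `2^m`, `y` of order `4`, `⟨a⟩ ∩ ⟨y⟩ = 1`): normal form, order, involutions

COR-CM (cell `pub-hodgecm2`), binder seat b04 (gen 34), count-neutral own lane «Galois-CM-type classification».  KERNEL ONLY,
Mathlib only: theorems; no definition, no named fact, no `sorry`.  Group-theoretic feeder of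
`CorCM/GaloisCyclicTimesFourIndexTwoDegenerate` (gen 34: an abelian subgroup `⟨a⟩ × ⟨y⟩ ≅ C_{2^m} × C₄` of index two of `Gal(K/ℚ)`
containing complex conjugation `c ≠ y²` makes the Galois CM field `K` BAD).  For commuting `a, y` in a group `G` with
`orderOf a = 2^m`, `y⁴ = 1 ≠ y²`, `⟨a⟩ ∩ ⟨y⟩ = 1`, and `A = closure {a, y}`:

* `one_of_zpow_mul_zpow_eq_one` — `aⁱ yʲ = 1 ⟹ aⁱ = 1 ∧ yʲ = 1`.
* `zpow_eq_one_or_eq_halfpower` — `a^(2i) = 1 ⟹ aⁱ ∈ {1, α}`, `α = a^(2^(m-1))`; `zpow_eq_one_or_eq_sq` — `y^(2j) = 1 ⟹ yʲ ∈ {1, y²}`.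
* `exists_eq_zpow_mul_zpow` — every element of `A` is `aⁱ yʲ`; `mul_comm_of_mem_closure` — `A` is abelian.
* `mul_card_le_card_closure` — `orderOf a · orderOf y ≤ |A|`.
* `involution_eq_halfpower_or` — an involution `c ∈ A` other than `y²` is `α` or `α y²`.
* `conj_halfpower_eq` — if `A ◁ G` and `m ≥ 3`, every `x ∈ G` fixes `α` by conjugation; `conj_sq_ne_halfpower` — and `x y² x⁻¹ ≠ α`.
-/

namespace Summit.HodgeConjecture.CorCM.GaloisModels.CyclicTimesFour

variable {G : Type*} [Group G] {a y : G}

/-- `⟨a⟩ ∩ ⟨y⟩ = 1` ⟹ (`aⁱ yʲ = 1 ⟹ aⁱ = 1 ∧ yʲ = 1`). [folklore] -/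
theorem one_of_zpow_mul_zpow_eq_one (hint : ∀ g : G, g ∈ Subgroup.zpowers a → g ∈ Subgroup.zpowers y → g = 1)
    (i j : ℤ) (h : a ^ i * y ^ j = 1) : a ^ i = 1 ∧ y ^ j = 1 := by
  have h1 : a ^ i = y ^ (-j) := by rw [zpow_neg, eq_inv_iff_mul_eq_one, h]
  have h2 : a ^ i = 1 := hint _ (Subgroup.zpow_mem _ (Subgroup.mem_zpowers a) i)
    (h1 ▸ Subgroup.zpow_mem _ (Subgroup.mem_zpowers y) (-j))
  refine ⟨h2, ?_⟩
  rwa [h2, one_mul] at h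

/-- `orderOf a = 2^m` (`m ≥ 1`), `a^(2i) = 1` ⟹ `aⁱ = 1` or `aⁱ = a^(2^(m-1))`. [folklore] -/
theorem zpow_eq_one_or_eq_halfpower {m : ℕ} (hm : 1 ≤ m) (ha : orderOf a = 2 ^ m) (i : ℤ) (hai : a ^ (2 * i) = 1) :
    a ^ i = 1 ∨ a ^ i = a ^ ((2 : ℤ) ^ (m - 1)) := by
  have h2m : ((2 : ℤ) ^ m) = 2 * 2 ^ (m - 1) := by rw [← pow_succ', Nat.sub_add_cancel hm]
  have ha2m : a ^ ((2 : ℤ) ^ m) = 1 := by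
    rw [show ((2 : ℤ) ^ m) = ((2 ^ m : ℕ) : ℤ) by push_cast; rfl, zpow_natCast, ← ha, pow_orderOf_eq_one]
  have hd : (orderOf a : ℤ) ∣ 2 * i := orderOf_dvd_iff_zpow_eq_one.2 hai
  rw [ha] at hd
  push_cast at hd
  rw [h2m] at hd
  obtain ⟨q, hq⟩ := hd
  have hi : i = 2 ^ (m - 1) * q := by linarith
  rcases Int.even_or_odd' q with ⟨r, hr | hr⟩
  · left
    rw [hi, hr, show (2 : ℤ) ^ (m - 1) * (2 * r) = (2 * 2 ^ (m - 1)) * r by ring, ← h2m, zpow_mul, ha2m, one_zpow]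
  · right
    rw [hi, hr, show (2 : ℤ) ^ (m - 1) * (2 * r + 1) = (2 * 2 ^ (m - 1)) * r + 2 ^ (m - 1) by ring, ← h2m, zpow_add,
      zpow_mul, ha2m, one_zpow, one_mul]

/-- `y⁴ = 1 ≠ y²`, `y^(2j) = 1` ⟹ `yʲ = 1` or `yʲ = y²`. [folklore] -/
theorem zpow_eq_one_or_eq_sq (hy4 : y ^ 4 = 1) (hy2 : y * y ≠ 1) (j : ℤ) (hyj : y ^ (2 * j) = 1) :
    y ^ j = 1 ∨ y ^ j = y * y := by
  have hy4z : y ^ (4 : ℤ) = 1 := by rw [show (4 : ℤ) = ((4 : ℕ) : ℤ) by norm_num, zpow_natCast, hy4]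
  rcases Int.even_or_odd' j with ⟨r, hr | hr⟩
  · rw [hr, zpow_mul, zpow_two]
    obtain ⟨s, hs | hs⟩ := Int.even_or_odd' r
    · left
      rw [hs, zpow_mul, show (y * y) ^ (2 : ℤ) = y ^ (4 : ℤ) by rw [← zpow_two, ← zpow_mul]; norm_num, hy4z, one_zpow]
    · right
      rw [hs, zpow_add, zpow_mul, show (y * y) ^ (2 : ℤ) = y ^ (4 : ℤ) by rw [← zpow_two, ← zpow_mul]; norm_num, hy4z,
        one_zpow, one_mul, zpow_one]
  · exfalso
    apply hy2
    rw [hr, show (2 : ℤ) * (2 * r + 1) = 4 * r + 2 by ring, zpow_add, zpow_mul, hy4z, one_zpow, one_mul, zpow_two] at hyj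
    exact hyj

/-- For commuting `a, y`: every element of `closure {a, y}` is `aⁱ yʲ`. [folklore] -/
theorem exists_eq_zpow_mul_zpow (hay : a * y = y * a) {u : G} (hu : u ∈ Subgroup.closure ({a, y} : Set G)) :
    ∃ i j : ℤ, u = a ^ i * y ^ j := by
  have hcomm : Commute a y := hay
  induction hu using Subgroup.closure_induction with
  | mem v hv =>
    simp only [Set.mem_insert_iff, Set.mem_singleton_iff] at hv
    rcases hv with rfl | rfl
    · exact ⟨1, 0, by rw [zpow_one, zpow_zero, mul_one]⟩
    · exact ⟨0, 1, by rw [zpow_zero, zpow_one, one_mul]⟩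
  | one => exact ⟨0, 0, by rw [zpow_zero, zpow_zero, mul_one]⟩
  | mul v w _ _ ihv ihw =>
    obtain ⟨i, j, rfl⟩ := ihv
    obtain ⟨k, l, rfl⟩ := ihw
    refine ⟨i + k, j + l, ?_⟩
    rw [zpow_add, zpow_add, show a ^ i * y ^ j * (a ^ k * y ^ l) = a ^ i * (y ^ j * a ^ k) * y ^ l by group,
      ← ((hcomm.zpow_right j).zpow_left k).eq]
    group
  | inv v _ ih =>
    obtain ⟨i, j, rfl⟩ := ih
    refine ⟨-i, -j, ?_⟩
    rw [mul_inv_rev, zpow_neg, zpow_neg, ← ((hcomm.zpow_right j).zpow_left i).inv_inv.eq]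

/-- For commuting `a, y`: `closure {a, y}` is abelian. [folklore] -/
theorem mul_comm_of_mem_closure (hay : a * y = y * a) {u v : G} (hu : u ∈ Subgroup.closure ({a, y} : Set G))
    (hv : v ∈ Subgroup.closure ({a, y} : Set G)) : u * v = v * u := by
  have hcomm : Commute a y := hay
  obtain ⟨i, j, rfl⟩ := exists_eq_zpow_mul_zpow hay hu
  obtain ⟨k, l, rfl⟩ := exists_eq_zpow_mul_zpow hay hv
  rw [show a ^ i * y ^ j * (a ^ k * y ^ l) = a ^ i * (y ^ j * a ^ k) * y ^ l by group,
    ← ((hcomm.zpow_right j).zpow_left k).eq,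
    show a ^ k * y ^ l * (a ^ i * y ^ j) = a ^ k * (y ^ l * a ^ i) * y ^ j by group,
    ← ((hcomm.zpow_right l).zpow_left i).eq]
  group

/-- `⟨a⟩ ∩ ⟨y⟩ = 1` ⟹ `orderOf a · orderOf y ≤ |closure {a, y}|`. [folklore] -/
theorem mul_card_le_card_closure [Finite G] (hint : ∀ g : G, g ∈ Subgroup.zpowers a → g ∈ Subgroup.zpowers y → g = 1) :
    orderOf a * orderOf y ≤ Nat.card (Subgroup.closure ({a, y} : Set G)) := by
  classical
  set A := Subgroup.closure ({a, y} : Set G)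
  have haA : a ∈ A := Subgroup.subset_closure (by simp)
  have hyA : y ∈ A := Subgroup.subset_closure (by simp)
  rw [← Nat.card_zpowers, ← Nat.card_zpowers, ← Nat.card_prod]
  let f : Subgroup.zpowers a × Subgroup.zpowers y → A := fun p =>
    ⟨p.1 * p.2, A.mul_mem ((Subgroup.zpowers_le.2 haA) p.1.2) ((Subgroup.zpowers_le.2 hyA) p.2.2)⟩
  refine Nat.card_le_card_of_injective f fun p q hpq => ?_
  exact Subgroup.mul_injective_of_disjoint (Subgroup.disjoint_def.2 (fun {g} h1 h2 => hint g h1 h2))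
    (congrArg Subtype.val hpq)

/-- An involution `c ∈ closure {a, y}` other than `y²` is `α = a^(2^(m-1))` or `α y²`. [folklore] -/
theorem involution_eq_halfpower_or (hay : a * y = y * a) {m : ℕ} (hm : 1 ≤ m) (ha : orderOf a = 2 ^ m) (hy4 : y ^ 4 = 1)
    (hy2 : y * y ≠ 1) (hint : ∀ g : G, g ∈ Subgroup.zpowers a → g ∈ Subgroup.zpowers y → g = 1) {c : G}
    (hcA : c ∈ Subgroup.closure ({a, y} : Set G)) (hcc : c * c = 1) (hc1 : c ≠ 1) (hct : c ≠ y * y) :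
    c = a ^ ((2 : ℤ) ^ (m - 1)) ∨ c = a ^ ((2 : ℤ) ^ (m - 1)) * (y * y) := by
  have hcomm : Commute a y := hay
  obtain ⟨i, j, hij⟩ := exists_eq_zpow_mul_zpow hay hcA
  have hsq : a ^ (2 * i) * y ^ (2 * j) = 1 := by
    rw [mul_comm (2 : ℤ) i, mul_comm (2 : ℤ) j, zpow_mul, zpow_mul, zpow_two, zpow_two,
      show a ^ i * a ^ i * (y ^ j * y ^ j) = a ^ i * (a ^ i * y ^ j) * y ^ j by group,
      ((hcomm.zpow_right j).zpow_left i).eq, show a ^ i * (y ^ j * a ^ i) * y ^ j = (a ^ i * y ^ j) * (a ^ i * y ^ j) by group,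
      ← hij, hcc]
  obtain ⟨hai, hyj⟩ := one_of_zpow_mul_zpow_eq_one hint (2 * i) (2 * j) hsq
  rcases zpow_eq_one_or_eq_halfpower hm ha i hai with h1 | h1 <;> rcases zpow_eq_one_or_eq_sq hy4 hy2 j hyj with h2 | h2
  · exact absurd (by rw [hij, h1, h2, one_mul]) hc1
  · exact absurd (by rw [hij, h1, h2, one_mul]) hct
  · exact Or.inl (by rw [hij, h1, h2, mul_one])
  · exact Or.inr (by rw [hij, h1, h2])

/-- If `closure {a, y} ◁ G` (`a, y` commuting, `orderOf a = 2^m`, `m ≥ 3`, `y⁴ = 1`), then every `x` fixes `α = a^(2^(m-1))`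
by conjugation: `(aᵏ yˡ)^(2^(m-1)) = αᵏ ∈ {1, α}`. [folklore] -/
theorem conj_halfpower_eq (hay : a * y = y * a) {m : ℕ} (hm : 3 ≤ m) (ha : orderOf a = 2 ^ m) (hy4 : y ^ 4 = 1)
    [hn : (Subgroup.closure ({a, y} : Set G)).Normal] (x : G) :
    x * a ^ ((2 : ℤ) ^ (m - 1)) * x⁻¹ = a ^ ((2 : ℤ) ^ (m - 1)) := by
  have hcomm : Commute a y := hay
  set α := a ^ ((2 : ℤ) ^ (m - 1)) with hα
  have h2m : ((2 : ℤ) ^ m) = 2 * 2 ^ (m - 1) := by rw [← pow_succ', Nat.sub_add_cancel (by omega)]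
  have ha2m : a ^ ((2 : ℤ) ^ m) = 1 := by
    rw [show ((2 : ℤ) ^ m) = ((2 ^ m : ℕ) : ℤ) by push_cast; rfl, zpow_natCast, ← ha, pow_orderOf_eq_one]
  have hy4z : y ^ (4 : ℤ) = 1 := by rw [show (4 : ℤ) = ((4 : ℕ) : ℤ) by norm_num, zpow_natCast, hy4]
  have hαα : α * α = 1 := by rw [hα, ← zpow_add, ← two_mul, ← h2m, ha2m]
  have hα1 : α ≠ 1 := by
    intro h
    have hd : (orderOf a : ℤ) ∣ 2 ^ (m - 1) := orderOf_dvd_iff_zpow_eq_one.2 h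
    rw [ha] at hd
    push_cast at hd
    have := Int.le_of_dvd (by positivity) hd
    have h0 : (0 : ℤ) < 2 ^ (m - 1) := by positivity
    have h' : (2 : ℤ) ^ (m - 1) < 2 ^ m := by rw [h2m]; linarith
    linarith
  obtain ⟨k, l, hkl⟩ := exists_eq_zpow_mul_zpow hay (hn.conj_mem a (Subgroup.subset_closure (by simp)) x)
  have h1 : x * α * x⁻¹ = (x * a * x⁻¹) ^ ((2 : ℤ) ^ (m - 1)) := by
    rw [hα, ← MulAut.conj_apply, map_zpow, MulAut.conj_apply]
  have h2 : (a ^ k * y ^ l) ^ ((2 : ℤ) ^ (m - 1)) = α ^ k := by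
    rw [((hcomm.zpow_right l).zpow_left k).mul_zpow, ← zpow_mul, ← zpow_mul, mul_comm k, zpow_mul, ← hα,
      show l * (2 : ℤ) ^ (m - 1) = 4 * (l * 2 ^ (m - 3)) by
        rw [show ((2 : ℤ) ^ (m - 1)) = 4 * 2 ^ (m - 3) by
          rw [show (4 : ℤ) = 2 ^ 2 by norm_num, ← pow_add, show 2 + (m - 3) = m - 1 by omega]]; ring,
      zpow_mul, hy4z, one_zpow, mul_one]
  have hαk : α ^ k = 1 ∨ α ^ k = α := by
    obtain ⟨r, hr | hr⟩ := Int.even_or_odd' k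
    · left
      rw [hr, zpow_mul, zpow_two, hαα, one_zpow]
    · right
      rw [hr, zpow_add, zpow_mul, zpow_two, hαα, one_zpow, one_mul, zpow_one]
  rw [h1, hkl, h2]
  rcases hαk with h | h
  · exfalso
    apply hα1
    have h3 : x * α * x⁻¹ = 1 := by rw [h1, hkl, h2, h]
    have := congrArg (fun g => x⁻¹ * g * x) h3
    simpa [mul_assoc] using this
  · exact h

/-- … and `x y² x⁻¹ ≠ α` (else `y² = α ∈ ⟨a⟩ ∩ ⟨y⟩`). [folklore] -/
theorem conj_sq_ne_halfpower (hay : a * y = y * a) {m : ℕ} (hm : 3 ≤ m) (ha : orderOf a = 2 ^ m) (hy4 : y ^ 4 = 1)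
    (hy2 : y * y ≠ 1) (hint : ∀ g : G, g ∈ Subgroup.zpowers a → g ∈ Subgroup.zpowers y → g = 1)
    [(Subgroup.closure ({a, y} : Set G)).Normal] (x : G) : x * (y * y) * x⁻¹ ≠ a ^ ((2 : ℤ) ^ (m - 1)) := by
  intro h
  rw [← conj_halfpower_eq hay hm ha hy4 x] at h
  have : y * y = a ^ ((2 : ℤ) ^ (m - 1)) := by
    have := congrArg (fun g => x⁻¹ * g * x) h
    simpa [mul_assoc] using this
  exact hy2 (hint (y * y) (this ▸ Subgroup.zpow_mem _ (Subgroup.mem_zpowers a) _)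
    (Subgroup.mul_mem _ (Subgroup.mem_zpowers y) (Subgroup.mem_zpowers y)))

end Summit.HodgeConjecture.CorCM.GaloisModels.CyclicTimesFour
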